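import Literature.AlgebraicGeometry.Resolution.CanonicalResolutionDatum
import Literature.AlgebraicGeometry.Resolution.MarkedIdealsRestrict
import HarnessLib

/-!
# Canonical resolution data ↔ the inner statement of `BierstoneGrigorievMilmanWlodarczyk2011_canonical` (proofs)

Topic: `Literature/AlgebraicGeometry/Resolution`. Companion of `CanonicalResolutionDatum.lean`
(proofs only: no new notions, no named facts). There a canonical resolution datum
`D : CanonicalResolutionDatum k n S` (a resolution of `j^*(𝔸ⁿ_k, 𝓘_Y, ∅, 1)` for every open
immersion `j : U → 𝔸ⁿ_k`, `Y = V(S)`, functorial for the open immersions between these opens in the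
sense of Bierstone–Grigoriev–Milman–Włodarczyk, arXiv:1206.3090, Thm. 8.0.5 (2), and equal up to
trivial steps to the blow-up of `Y ∩ U` over the regular locus of an integral `Y`) was shown to
YIELD the inner statement (i) ∧ (ii) of the named fact `BierstoneGrigorievMilmanWlodarczyk2011_canonical`
(`CanonicalResolution.lean`; Thm. 8.0.5 with Lemma 8.0.3 (1) and Cor. 8.0.6–8.0.7 for the marked
ideal `(𝔸ⁿ_k, (S), ∅, 1)`) for the input `(k, n, S)` (`CanonicalResolutionDatum.inner`), so that
data in characteristic `p > M(d, n, l)` give the named fact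
(`bierstoneGrigorievMilmanWlodarczyk2011_canonical_of_datum`).

This file PROVES the converse, instance by instance, so that the datum form is an INTERFACE
EQUIVALENT to the inner statement and not a lower layer of the decomposition: BGMW's
functoriality clause (2) for OPEN IMMERSIONS is automatic for the restrictions of one global
sequence — Def. 3.1.5, Remark (1): "The definition of extension arises naturally when we pass to
open subsets of the ambient variety `X`". Given a sequence `s` with (i) ∧ (ii), the assignment
`U ↦ s|U` (`CentreSeq.restrict`, the induced sequence `φ^*(X_i)` of Thm. 8.0.5 for `φ = j`,
GW Prop. 13.91) is a datum (`CanonicalResolutionDatum.nonempty_of_inner`):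
(a) `s|U` resolves `j^*(𝔸ⁿ_k, 𝓘_Y, ∅, 1)` (`CentreSeq.IsResolutionOf.restrict`,
`MarkedIdealsRestrict.lean`); (b) `(s|U)|V = s|V` on the nose (`restrict_eq_comap`, `comap_comp`),
in particular an extension of it (`IsExtensionOf.refl`); (c) is clause (ii) verbatim. Hence
`Nonempty (CanonicalResolutionDatum k n S) ↔ (i) ∧ (ii)` (`CanonicalResolutionDatum.nonempty_iff_inner`),
the named fact yields data in characteristic `p > M(d, n, l)` with its own threshold `M`
(`canonicalDatum_of_canonical`), and "data in large characteristic" is equivalent to the named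
fact (`canonicalDatum_iff_canonical`). (An earlier revision vendored "data in large
characteristic" as a separate named fact `BierstoneGrigorievMilmanWlodarczyk2011_canonicalDatum`;
being equivalent to `BierstoneGrigorievMilmanWlodarczyk2011_canonical` it has been merged back
into it, D-0026: the statements below spell the datum form out instead of naming it.)

Consequently the remaining input below the named fact is one and the same in both presentations:
BGMW Thm. 8.0.5 itself (the canonical resolution algorithm of §4 run in characteristic `p > M̄`,
§8) for the marked ideal `(𝔸ⁿ_k, (S), ∅, 1)`, i.e. clause (i) (existence of a resolution,
Def. 3.1.3) together with clause (ii) (its shape over the regular locus of `Y`).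

## Sources

* E. Bierstone, D. Grigoriev, P. Milman, J. Włodarczyk, *Effective Hironaka resolution and its
  complexity (with appendix on applications in positive characteristic)*, arXiv:1206.3090 (arXiv
  numbering): Def. 3.1.5 and Remark (1) (p. 6); Thm. 8.0.5 (1)–(2), Lemma 8.0.3 (1),
  Cor. 8.0.6–8.0.7 (p. 23). [BierstoneGrigorievMilmanWlodarczyk2011]
* U. Görtz, T. Wedhorn, *Algebraic Geometry I*, 2nd ed. (2020), Prop. 13.91 (1)–(2) — through
  `BlowupSequences.lean`. [GortzWedhorn2020]
-/

noncomputable section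

open CategoryTheory CategoryTheory.Limits AlgebraicGeometry TopologicalSpace Topology

namespace Literature.AlgebraicGeometry.Resolution

/-! ## Instance by instance: a sequence with (i) ∧ (ii) gives a datum -/

/-- **A global sequence `s` resolving `(𝔸ⁿ_k, 𝓘_Y, ∅, 1)` with the canonical shape over the
regular locus gives a canonical resolution datum**, namely `U ↦ s|U`: (a) `s|U` resolves
`j^*(𝔸ⁿ_k, 𝓘_Y, ∅, 1)` (`CentreSeq.IsResolutionOf.restrict`, BGMW Def. 3.1.5 Remark (1));
(b) `(s|U)|V = s|V` (`restrict_eq_comap`, `comap_comp`), in particular an extension of it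
(Thm. 8.0.5 (2) for the open immersion `V → U` holds on the nose); (c) is clause (ii).
[cite: BierstoneGrigorievMilmanWlodarczyk2011, Thm. 8.0.5 (2) with Def. 3.1.5 Remark (1)] -/
theorem CanonicalResolutionDatum.nonempty_of_inner {k : Type} [Field k] {n : ℕ}
    {S : Finset (MvPolynomial (Fin n) k)}
    (h : ∃ s : CentreSeq (Spec (CommRingCat.of (MvPolynomial (Fin n) k))),
      s.IsResolutionOf ⟨(affineZeroLocusι k n S).ker, [], 1⟩ ∧
      (IsIntegral (affineZeroLocus k n S) →
        ∀ (U : Scheme.{0}) (j : U ⟶ Spec (CommRingCat.of (MvPolynomial (Fin n) k)))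
          [IsOpenImmersion j],
          (∃ y : affineZeroLocus k n S, affineZeroLocusι k n S y ∈ Set.range j) →
          (∀ y : affineZeroLocus k n S, affineZeroLocusι k n S y ∈ Set.range j →
            IsRegularLocalRing ((affineZeroLocus k n S).presheaf.stalk y)) →
            (s.restrict j).IsExtensionOfSingle ((affineZeroLocusι k n S).ker.comap j))) :
    Nonempty (CanonicalResolutionDatum k n S) := by
  obtain ⟨s, hs, hii⟩ := h
  exact ⟨{
    seq := fun U j hj => by
      haveI := hj
      exact s.restrict j
    isResolutionOf := fun U j hj => by
      haveI := hj
      haveI : IsLocallyNoetherian U := LocallyOfFiniteType.isLocallyNoetherian j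
      exact hs.restrict j
    restrict_isExtensionOf := fun U j hj V g hg => by
      haveI := hj
      haveI := hg
      change ((s.restrict j).restrict g).IsExtensionOf (s.restrict (g ≫ j))
      rw [CentreSeq.restrict_eq_comap, CentreSeq.restrict_eq_comap, CentreSeq.restrict_eq_comap,
        ← CentreSeq.comap_comp]
      exact CentreSeq.IsExtensionOf.refl _
    isExtensionOfSingle := fun U j hj hint hmeet hreg => by
      haveI := hj
      exact hii hint U j hmeet hreg }⟩

/-- **Canonical resolution data for `(k, n, S)` exist iff the inner statement (i) ∧ (ii) of
`BierstoneGrigorievMilmanWlodarczyk2011_canonical` holds for `(k, n, S)`**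
(`CanonicalResolutionDatum.inner` and `CanonicalResolutionDatum.nonempty_of_inner`): the datum
form is an interface equivalent to the inner statement, the functoriality under the open
immersions between opens of `𝔸ⁿ_k` being free for restrictions of one global sequence.
[cite: BierstoneGrigorievMilmanWlodarczyk2011, Thm. 8.0.5 (2) with Def. 3.1.5 Remark (1)] -/
theorem CanonicalResolutionDatum.nonempty_iff_inner {k : Type} [Field k] {n : ℕ}
    {S : Finset (MvPolynomial (Fin n) k)} :
    Nonempty (CanonicalResolutionDatum k n S) ↔
      ∃ s : CentreSeq (Spec (CommRingCat.of (MvPolynomial (Fin n) k))),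
        s.IsResolutionOf ⟨(affineZeroLocusι k n S).ker, [], 1⟩ ∧
        (IsIntegral (affineZeroLocus k n S) →
          ∀ (U : Scheme.{0}) (j : U ⟶ Spec (CommRingCat.of (MvPolynomial (Fin n) k)))
            [IsOpenImmersion j],
            (∃ y : affineZeroLocus k n S, affineZeroLocusι k n S y ∈ Set.range j) →
            (∀ y : affineZeroLocus k n S, affineZeroLocusι k n S y ∈ Set.range j →
              IsRegularLocalRing ((affineZeroLocus k n S).presheaf.stalk y)) →
              (s.restrict j).IsExtensionOfSingle ((affineZeroLocusι k n S).ker.comap j)) :=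
  ⟨fun ⟨D⟩ => D.inner, CanonicalResolutionDatum.nonempty_of_inner⟩

/-! ## Globally: the named fact gives data in characteristic `p > M(d, n, l)` -/

/-- **`BierstoneGrigorievMilmanWlodarczyk2011_canonical` yields canonical resolution data in
characteristic `p > M(d, n, l)`**, with the threshold `M` of the fact: given its global sequence
`s` for `(k, n, S)`, the restrictions `U ↦ s|U` form a `CanonicalResolutionDatum k n S`
(`CanonicalResolutionDatum.nonempty_of_inner`). The converse is
`bierstoneGrigorievMilmanWlodarczyk2011_canonical_of_datum` (`CanonicalResolutionDatum.lean`).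
[cite: BierstoneGrigorievMilmanWlodarczyk2011, Thm. 8.0.5 (2) with Def. 3.1.5 Remark (1)] -/
theorem canonicalDatum_of_canonical (h : BierstoneGrigorievMilmanWlodarczyk2011_canonical) :
    ∃ M : ℕ → ℕ → ℕ → ℕ, ∀ (p : ℕ), p.Prime →
      ∀ (k : Type) [Field k] [CharP k p] [PerfectField k] (n d l : ℕ)
        (S : Finset (MvPolynomial (Fin n) k)),
        S.card ≤ l → (∀ f ∈ S, f.totalDegree ≤ d) → M d n l < p →
          Nonempty (CanonicalResolutionDatum k n S) := by
  obtain ⟨M, hM⟩ := h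
  exact ⟨M, fun p hp k _ _ _ n d l S hS hd hMp =>
    CanonicalResolutionDatum.nonempty_of_inner (hM p hp k n d l S hS hd hMp)⟩

/-- **Canonical resolution data in characteristic `p > M(d, n, l)` ↔
`BierstoneGrigorievMilmanWlodarczyk2011_canonical`** (`bierstoneGrigorievMilmanWlodarczyk2011_canonical_of_datum`
and `canonicalDatum_of_canonical`): the datum form of BGMW Thm. 8.0.5 for `(𝔸ⁿ_k, (S), ∅, 1)`
does not add strength to the named fact.
[cite: BierstoneGrigorievMilmanWlodarczyk2011, Thm. 8.0.5 (2) with Def. 3.1.5 Remark (1)] -/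
theorem canonicalDatum_iff_canonical :
    (∃ M : ℕ → ℕ → ℕ → ℕ, ∀ (p : ℕ), p.Prime →
      ∀ (k : Type) [Field k] [CharP k p] [PerfectField k] (n d l : ℕ)
        (S : Finset (MvPolynomial (Fin n) k)),
        S.card ≤ l → (∀ f ∈ S, f.totalDegree ≤ d) → M d n l < p →
          Nonempty (CanonicalResolutionDatum k n S)) ↔
      BierstoneGrigorievMilmanWlodarczyk2011_canonical :=
  ⟨bierstoneGrigorievMilmanWlodarczyk2011_canonical_of_datum, canonicalDatum_of_canonical⟩

end Literature.AlgebraicGeometry.Resolution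

end
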